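import Summits.BirchSwinnertonDyer.BirchSwinnertonDyer.Theorems.ByReductionTypeAtTwoOrdKatoHalfAtTwoIsoConjATwoOfTotallyComplexMu
import Summits.BirchSwinnertonDyer.BirchSwinnertonDyer.Theorems.AlignedTransportAtTwoMainConjectureOfRankZeroBSDAtTwoFineRoadDiscriminantSign
import HarnessLib
/-!
# Route `ByReductionTypeAtTwo` (K4), crux 202 `OrdKatoHalfAtTwoIso` (stmt-BirchSwinnertonDyer-19573), line `steinberg-fibre-at-two`:
# statement (A) at `2` over `ℚ` from `μ₂ = 0` of the `2`-DIVISION FIELD `ℚ(E[2])` on the half-cell `Δ_E < 0`, and Lim 2017 Thm. 3.5 at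
# `p = 2` DOWNSTAIRS in its honest kernel scope «`L` totally complex» (KERNEL; theorems only)

Seat `cruxlead-stmt-BirchSwinnertonDyer-19573-w2` GEN 7 (prover WIDTH under the LEAD lineage; HOME `run/shared/lean/pub/bsd-2adic/`;
`--supports stmt-BirchSwinnertonDyer-19573`). Sequel of `…ConjATwoOfTotallyComplexMu` (same seat): the `K = ℚ` specialisations. HONEST
FRAMING (cell bsd-2adic): THEOREMS ONLY — no definition, no named fact, no `sorry`; nothing here proves the crux, Q⁺ (whose cell is `0 < Δ`,
the OTHER sign), B7′ or BSD; Iwasawa's `μ₂ = 0` for the non-abelian sextic `ℚ(E[2])` is OPEN in general (per-curve certificates only).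

* §1 (any number field `K`) **`exists_isComplexConjugationAt_smul_eq_of_isReal`** — a REAL place of a finite `L ⊆ K̄` produces a complex
  conjugation `c ∈ Γ_K` at the real place of `K` below it which FIXES `L` pointwise (extend the place's real embedding to `ι : K̄ → ℂ`;
  `conj ∘ ι` lies over the same embedding of `K`, so `conj ∘ ι = ι ∘ c`; `ι` is real on `L`). The converse bookkeeping of the tree's
  `HilbertClassFieldRealPlaces.isReal_of_forall_isComplexConjugationAt` (Cox §5.A), for a not necessarily normal `L`.
* §2 (`K = ℚ`) **`isComplex_infinitePlace_divisionField_two_of_Δ_neg`** — `Δ_E < 0` ⟹ every infinite place of `ℚ(E[2])` is complex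
  (att-p5 `FineRoadDiscriminantSign.Δ_neg_iff_not_mem_fixingSubgroup_divisionField`: complex conjugation does not fix `ℚ(E[2])`);
  **`conjA_two_of_classicalMu_divisionField_two_of_Δ_neg`** — statement (A) at `(E, 2)` (`∃ γ D` form) for EVERY `E/ℚ` with `Δ_E < 0`
  from `μ₂ = 0` of the cyclotomic `ℤ₂`-extension(s) of `ℚ(E[2])` ALONE (at most sextic, totally complex; no `√−1`, no Lim fact, no ascent;
  carrier degree 6 against the dodecic `ℚ(E[2], √−1)` of Iw⁻-type inputs), with the relaxed-at-`∞` twin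
  `finite_twoTorsion_fineRelaxed_of_classicalMu_divisionField_two_of_Δ_neg`.
* §3 (`K = ℚ`) **`thm35_at_two_of_le_divisionField_four_of_isTotallyComplex`** — the binders of the downstairs named fact
  `Lim2017.thm35_at_two_fineSelmerDual_moduleFinite_of_classicalMuVanishes_of_le_divisionField_four` VERBATIM plus the guard «every
  infinite place of `L` is complex», PROVED (pen RC-457 D-audit ask: this is the kernel scope; nothing is asserted about carriers with a
  real place); **`…_of_sq_eq_neg_one_mem`** — the guard discharged by `√−1 ∈ L` (e.g. `L = ℚ(E[2], i)`, `ℚ(P, i)`, `ℚ(√Δ, i)`).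

References: [Lim2017FineSelmer] §3 Thm. 3.5, Lemma 3.2, proof of Thm. 3.1; [CoatesSujatha2005] statement (A), Thm. 3.4; [Cox2013] §5.A
(p. 98: real places and complex conjugations); [SilvermanAEC2009] III.1 (`16Δ` = discriminant of the `2`-division cubic), VIII.§1;
[Iwasawa1973MuInvariants] Thm. 2/3 (NOT used); tree `…ConjATwoOfTotallyComplexMu` (this seat), `…FineRoadDiscriminantSign` (att-p5),
`HilbertClassFieldRealPlaces` (dictionary), p716773 (`isComplex_of_mem_sq_eq_neg_one`).
-/

set_option autoImplicit false
-- the Theorems namespace of this sub repeats the summit name by design (D-0017 nested layout)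
set_option linter.dupNamespace false

noncomputable section

open scoped Classical

namespace Summit.BirchSwinnertonDyer.BirchSwinnertonDyer.Theorems.SteinbergFibreAtTwo.TotallyComplexMu

open WeierstrassCurve NumberField IsDedekindDomain Field
open Literature.NumberTheory.EllipticCurves Literature.NumberTheory.EllipticCurves.GreenbergSelmer
  Literature.NumberTheory.GaloisRepresentations Literature.NumberTheory.IwasawaTheory
open Summit.BirchSwinnertonDyer.BirchSwinnertonDyer.Theorems.AlignedTransportAtTwoFineRoad

/-! ## §1 A real place of a finite `L ⊆ K̄` yields a complex conjugation of `Γ_K` fixing `L` -/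

section RealPlace

variable {K : Type} [Field K] [NumberField K]

/-- **A real place of a finite extension `L ⊆ K̄` of `K` comes from a complex conjugation of `Γ_K` FIXING `L`.** If `W` is a real
infinite place of `L`, then there are a real place `w` of `K` (the place below `W`) and `c ∈ Γ_K`, a complex conjugation AT `w`
(`IsComplexConjugationAt`), with `c • x = x` for every `x ∈ L`: extend the real embedding `τ` of `W` to `ι : K̄ → ℂ`; `conj ∘ ι` and `ι` agree
on `K`, so `conj ∘ ι = ι ∘ c` for some `c ∈ Gal(K̄/K)` (`K̄/K` Galois); and `ι (c • x) = conj (τ x) = τ x = ι x` on `L`. No normality of `L`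
is used. [cite: Cox2013, §5.A (p. 98: «an infinite prime σ of K ramifies in L if σ is real but it has an extension to L which is complex»)]
[cite: NeukirchANT1999, Ch. III §1 (real and complex primes)] -/
theorem exists_isComplexConjugationAt_smul_eq_of_isReal (L : IntermediateField K (AlgebraicClosure K)) [FiniteDimensional K L]
    (V : InfinitePlace L) (hV : V.IsReal) :
    ∃ (w : InfinitePlace K) (hw : w.IsReal) (c : absoluteGaloisGroup K),
      IsComplexConjugationAt hw c ∧ ∀ x : AlgebraicClosure K, x ∈ L → c • x = x := by
  classical
  haveI : IsGalois K (AlgebraicClosure K) := {}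
  set τ : L →+* ℂ := V.embedding with hτdef
  have hVτ : InfinitePlace.mk τ = V := InfinitePlace.mk_embedding V
  have hτreal : ComplexEmbedding.IsReal τ := InfinitePlace.isReal_iff.mp hV
  set φ₀ : K →+* ℂ := τ.comp (algebraMap K L) with hφ₀def
  have hwφ₀ : V.comap (algebraMap K L) = InfinitePlace.mk φ₀ := by
    rw [← hVτ, InfinitePlace.comap_mk]
  have hφ₀real : ComplexEmbedding.IsReal φ₀ := by
    rw [ComplexEmbedding.isReal_iff]
    ext1 x
    rw [hφ₀def, ComplexEmbedding.conjugate_coe_eq, RingHom.comp_apply]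
    have h := RingHom.congr_fun hτreal (algebraMap K L x)
    rw [ComplexEmbedding.conjugate_coe_eq] at h
    exact h
  have hW : (V.comap (algebraMap K L)).IsReal := by
    rw [hwφ₀]; exact InfinitePlace.isReal_mk_iff.mpr hφ₀real
  -- extend `τ` to `ι : K̄ → ℂ`
  haveI : Algebra.IsAlgebraic L (AlgebraicClosure K) := Algebra.IsAlgebraic.tower_top (K := K) L
  set ι : AlgebraicClosure K →+* ℂ := ComplexEmbedding.lift (AlgebraicClosure K) τ with hιdef
  have hιτ : ι.comp (algebraMap L (AlgebraicClosure K)) = τ := ComplexEmbedding.lift_comp_algebraMap (AlgebraicClosure K) τ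
  have hιK : ι.comp (algebraMap K (AlgebraicClosure K)) = φ₀ := by
    rw [hφ₀def, ← hιτ, RingHom.comp_assoc, ← IsScalarTower.algebraMap_eq K L (AlgebraicClosure K)]
  -- `conj ∘ ι` lies over the same real embedding `φ₀`
  have hιK' : (ComplexEmbedding.conjugate ι).comp (algebraMap K (AlgebraicClosure K)) = φ₀ := by
    ext1 x
    have hx := RingHom.congr_fun hιK x
    rw [RingHom.comp_apply] at hx
    rw [RingHom.comp_apply, ComplexEmbedding.conjugate_coe_eq, hx]
    exact RingHom.congr_fun hφ₀real x
  obtain ⟨σ, hσ⟩ := ComplexEmbedding.exists_comp_symm_eq_of_comp_eq (k := K) (K := AlgebraicClosure K) _ _ (hιK.trans hιK'.symm)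
  -- `c = σ⁻¹` is a complex conjugation at the real place `w = V|_K`
  set c : absoluteGaloisGroup K := (absoluteGaloisGroup.toAlgEquiv K).symm σ.symm with hcdef
  have hconj : ComplexEmbedding.IsConj ι (absoluteGaloisGroup.toAlgEquiv K c) := by
    rw [hcdef, MulEquiv.apply_symm_apply]
    exact hσ.symm
  have hc : IsComplexConjugationAt hW c := by
    rw [isComplexConjugationAt_iff]
    refine ⟨ι, ComplexEmbedding.liesOver_iff.mpr ?_, hconj⟩
    rw [hιK, hwφ₀, InfinitePlace.embedding_mk_eq_of_isReal hφ₀real]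
  refine ⟨V.comap (algebraMap K L), hW, c, hc, fun x hx ↦ ?_⟩
  -- `ι (c • x) = conj (ι x) = ι x` for `x ∈ L` (`τ` is real)
  have h1 : ι (c • x) = star (ι x) := by
    rw [absoluteGaloisGroup.smul_def]; exact hconj.eq x
  have h2 : star (ι x) = ι x := by
    have h := RingHom.congr_fun hτreal ⟨x, hx⟩
    rw [ComplexEmbedding.conjugate_coe_eq, ← hιτ, RingHom.comp_apply] at h
    exact h
  rw [h2] at h1
  exact ι.injective h1

end RealPlace

/-! ## §2 `K = ℚ`: the half-cell `Δ_E < 0` — `ℚ(E[2])` is totally complex; statement (A) from `μ₂(ℚ(E[2])^{cyc}) = 0` -/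

section RatNegDisc

variable (W : WeierstrassCurve ℚ) [W.IsElliptic]

/-- **`Δ_E < 0` ⟹ the `2`-division field `ℚ(E[2])` is TOTALLY COMPLEX** (every infinite place is complex): a real place of `ℚ(E[2])`
would give a complex conjugation `c ∈ Gal(ℚ̄/ℚ)` fixing `ℚ(E[2])` (§1), i.e. `c ∈ Gal(ℚ̄/ℚ(E[2]))`, whereas for `Δ_E < 0` NO complex
conjugation fixes `ℚ(E[2])` (`FineRoadDiscriminantSign.Δ_neg_iff_not_mem_fixingSubgroup_divisionField`: it moves a `2`-torsion point — one
real root of the `2`-division cubic). [cite: SilvermanAEC2009, III.1 (16Δ = disc of the 2-division cubic) and VIII.§1] [cite: Cox2013, §5.A (p. 98)] -/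
theorem isComplex_infinitePlace_divisionField_two_of_Δ_neg (hΔ : W.Δ < 0) (v : InfinitePlace (W.divisionField 2)) : v.IsComplex := by
  haveI : NeZero (2 : ℕ) := ⟨two_ne_zero⟩
  rw [← InfinitePlace.not_isReal_iff_isComplex]
  intro hv
  obtain ⟨w, hw, c, hc, hfix⟩ := exists_isComplexConjugationAt_smul_eq_of_isReal (W.divisionField 2) v hv
  have hc' : IsComplexConjugation (Rat.castHom ℝ) c := by
    have e : InfinitePlace.embedding_of_isReal hw = Rat.castHom ℝ := Subsingleton.elim _ _
    rw [← e]; exact hc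
  have hmem : c ∈ (W.divisionField 2).fixingSubgroup := by
    refine (IntermediateField.mem_fixingSubgroup_iff _ (absoluteGaloisGroup.toAlgEquiv ℚ c)).2 fun x hx ↦ ?_
    rw [← absoluteGaloisGroup.smul_def]
    exact hfix x hx
  exact (DiscriminantSign.Δ_neg_iff_not_mem_fixingSubgroup_divisionField W hc').mp hΔ hmem

/-- **Statement (A) at `(E, 2)` for every `E/ℚ` with `Δ_E < 0` from `μ₂ = 0` of the cyclotomic `ℤ₂`-extension(s) of `ℚ(E[2])` ALONE**
(`∃ γ D` form; the carrier is the `2`-division field itself — totally complex by `isComplex_infinitePlace_divisionField_two_of_Δ_neg`, acting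
trivially on `E[2]`; `…TotallyComplexMu.exists_fineSelmerDualData_moduleFinite_of_classicalMu_divisionField_two`). No `√−1` adjoined, no
Lim named fact, no Iwasawa ascent; when `E[2]` is irreducible `ℚ(E[2])` is the totally complex `S₃`-sextic, when `E[2]` is reducible it is
an imaginary quadratic field or `ℚ` is excluded (`Δ < 0` forces `[ℚ(E[2]) : ℚ] ∈ {2, 6}`). Iwasawa's `μ₂ = 0` for such fields is OPEN in
general (kernel per class, e.g. the cell's Fukuda certificates). [cite: Lim2017FineSelmer, §3 Thm. 3.5, Lemma 3.2 and proof of Thm. 3.1]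
[cite: CoatesSujatha2005, statement (A), Thm. 3.4] [cite: SilvermanAEC2009, III.1] -/
theorem conjA_two_of_classicalMu_divisionField_two_of_Δ_neg (hΔ : W.Δ < 0)
    (hμ : ∀ κF : ZpExtension (W.divisionField 2) 2, κF.IsCyclotomic → ClassicalMuVanishes κF)
    (κ : ZpExtension ℚ 2) (hκ : κ.IsCyclotomic) :
    ∃ (γ : absoluteGaloisGroup ℚ) (D : W.FineSelmerDualData κ γ),
      Module.Finite ℤ_[2] (RestrictScalars ℤ_[2] (IwasawaAlgebra 2) D.X) :=
  exists_fineSelmerDualData_moduleFinite_of_classicalMu_divisionField_two W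
    (isComplex_infinitePlace_divisionField_two_of_Δ_neg W hΔ) hμ κ hκ

/-- The RELAXED-at-`∞` twin on `Δ_E < 0`: `Sel₀^{rel ∞}(ℚ_∞, E[2^∞])[2]` is finite from `μ₂(ℚ(E[2])^{cyc}) = 0` (the currency of B7′'s
`μ`-doors and of C2's Limʳ). [cite: Lim2017FineSelmer, §3 Thm. 3.5 and Lemma 3.2] [cite: GreenbergLNM1716, §4 Lemma 4.6] -/
theorem finite_twoTorsion_fineRelaxed_of_classicalMu_divisionField_two_of_Δ_neg (hΔ : W.Δ < 0)
    (hμ : ∀ κF : ZpExtension (W.divisionField 2) 2, κF.IsCyclotomic → ClassicalMuVanishes κF)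
    (κ : ZpExtension ℚ 2) (hκ : κ.IsCyclotomic) :
    Set.Finite {s : W.fineSelmerInftyRelaxedInf κ | 2 • s = 0} :=
  haveI : NeZero (2 : ℕ) := ⟨two_ne_zero⟩
  finite_twoTorsion_fineRelaxed_of_classicalMu_of_le_divisionField W (W.divisionField 2) (dvd_refl 2) le_rfl
    ⟨0, by rw [pow_zero, one_mul]⟩ (isComplex_infinitePlace_divisionField_two_of_Δ_neg W hΔ) hμ κ hκ

end RatNegDisc

/-! ## §3 `K = ℚ`: the downstairs named fact `Lim2017.thm35_at_two_…_of_le_divisionField_four` in its kernel scope -/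

section NamedFactScope

/-- **Lim 2017 Thm. 3.5 with Lemma 3.2 at `p = 2`, DOWNSTAIRS, for a TOTALLY COMPLEX carrier — PROVED.** For every elliptic `W/ℚ`, every
`L ⊆ ℚ(E[4])` with `[ℚ(E[4]) : ℚ] = 2^k · [L : ℚ]` ALL OF WHOSE INFINITE PLACES ARE COMPLEX, Iwasawa's classical `μ₂ = 0` for the cyclotomic
`ℤ₂`-extension(s) of `L` implies Coates–Sujatha's statement (A) at `(E, 2)` over `ℚ^{cyc}` in the `∃ γ D` form. These are the binders of the
Literature named fact `Lim2017.thm35_at_two_fineSelmerDual_moduleFinite_of_classicalMuVanishes_of_le_divisionField_four` VERBATIM plus the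
archimedean guard, which is where print itself stands (Lim's proof of Thm. 3.1: «so that `F` contains `μ_{2p}` (in particular, `F` has no real
primes)»; Iwasawa 1973 Thm. 2/3: «let `k` be totally imaginary if `ℓ = 2`»). The unguarded fact is NOT claimed: at a carrier with a real place
the argument leaks (narrow `μ₂`). [cite: Lim2017FineSelmer, §3 Thm. 3.5, Lemma 3.2, proof of Thm. 3.1 (arXiv:1306.2047 pp. 6–7)]
[cite: Iwasawa1973MuInvariants, Thm. 2 and Thm. 3 («let k be totally imaginary if ℓ = 2»)] [cite: CoatesSujatha2005, statement (A) and Thm. 3.4] -/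
theorem thm35_at_two_of_le_divisionField_four_of_isTotallyComplex :
    ∀ (W : WeierstrassCurve ℚ) [W.IsElliptic],
      ∀ (L : IntermediateField ℚ (AlgebraicClosure ℚ)), L ≤ W.divisionField 4 →
        (∃ k : ℕ, Module.finrank ℚ (W.divisionField 4) = 2 ^ k * Module.finrank ℚ L) →
        (∀ v : InfinitePlace L, v.IsComplex) →
        (∀ κL : ZpExtension L 2, κL.IsCyclotomic → ClassicalMuVanishes κL) →
        ∀ (κ : ZpExtension ℚ 2), κ.IsCyclotomic →
          ∃ (γ : Field.absoluteGaloisGroup ℚ) (D : W.FineSelmerDualData κ γ),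
            Module.Finite ℤ_[2] (RestrictScalars ℤ_[2] (IwasawaAlgebra 2) D.X) := by
  intro W _ L hL hk hLc hμ κ hκ
  haveI : NeZero (4 : ℕ) := ⟨by norm_num⟩
  exact exists_fineSelmerDualData_moduleFinite_of_classicalMu_of_le_divisionField W L (by norm_num : 2 ∣ 4) hL hk hLc hμ κ hκ

/-- **The guard discharged by `√−1 ∈ L`.** For `L ⊆ ℚ(E[4])` of `2`-power index CONTAINING a square root of `−1` (e.g. `ℚ(E[2], i)`,
`ℚ(P, i)`, `ℚ(√Δ, i)` — `i ∈ ℚ(E[4])` by the Weil pairing), `L` is totally complex (p716773 `FineSelmerUpstairs.isComplex_of_mem_sq_eq_neg_one`),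
so `μ₂(L^{cyc}) = 0` gives statement (A) at `(E, 2)`. [cite: Lim2017FineSelmer, §3 Thm. 3.5 and proof of Thm. 3.1 («F contains μ_{2p}»)]
[cite: CoatesSujatha2005, statement (A) and Thm. 3.4] -/
theorem thm35_at_two_of_le_divisionField_four_of_sq_eq_neg_one_mem (W : WeierstrassCurve ℚ) [W.IsElliptic]
    (L : IntermediateField ℚ (AlgebraicClosure ℚ)) (hL : L ≤ W.divisionField 4)
    (hk : ∃ k : ℕ, Module.finrank ℚ (W.divisionField 4) = 2 ^ k * Module.finrank ℚ L)
    {i : AlgebraicClosure ℚ} (hi : i ^ 2 = -1) (hiL : i ∈ L)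
    (hμ : ∀ κL : ZpExtension L 2, κL.IsCyclotomic → ClassicalMuVanishes κL)
    (κ : ZpExtension ℚ 2) (hκ : κ.IsCyclotomic) :
    ∃ (γ : Field.absoluteGaloisGroup ℚ) (D : W.FineSelmerDualData κ γ),
      Module.Finite ℤ_[2] (RestrictScalars ℤ_[2] (IwasawaAlgebra 2) D.X) :=
  thm35_at_two_of_le_divisionField_four_of_isTotallyComplex W L hL hk
    (FineSelmerUpstairs.isComplex_of_mem_sq_eq_neg_one i hi L hiL) hμ κ hκ

end NamedFactScope

end Summit.BirchSwinnertonDyer.BirchSwinnertonDyer.Theorems.SteinbergFibreAtTwo.TotallyComplexMu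

end
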